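import Summits.KontsevichZagierPeriods.KontsevichZagierPeriods.Theorems.FermatIsogenyBetaLinearSectorStubUpperSector
import Mathlib.Analysis.SpecialFunctions.Trigonometric.Basic
import Mathlib.Tactic.Module
import Mathlib.Tactic.LinearCombination
import HarnessLib

/-!
# `BetaLinearSector` (stmt-KontsevichZagierPeriods-3897) — section `Sector`: THE TWO-TERM RELATION

Registered stub `stub_twoTermRelation` of line `fermat-sector-transport` (lead c4): for positive `r, s, t` with `r + s + t = N`,

  `(F_N, ω_{r,s}, γ_N) − κ (F_N, ω_{t,s}, γ_N) ∼ 0`,   `κ = sin(π(r+s)/N) / sin(πr/N)`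

(on periods: `B(a,b) sin πa = B(1−a−b, b) sin π(a+b)`), obtained by eliminating `(F_N, ω_{r,t}, γ_N)` between the upper
sector relations (`stub_upperSector`) for `(r,s,t)` and `(t,s,r)` with the swap `(ω_{t,r}, γ_N) ∼ (ω_{r,t}, γ_N)`
(`stub_swapRel` on `γ_N⁻ = swap ∘ γ_N`, and path reversal); the coefficient algebra is `ε^t = −ε̄^{r+s}`,
`ε^m − ε̄^m = 2i sin(πm/N)` (`ε = e^{iπ/N}`).

References: B. Gross (appendix by D. Rohrlich), Invent. Math. 45 (1978), §1; A. Huber, G. Wüstholz, *Transcendence and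
linear relations of 1-periods* (2022), §13.1.
-/

noncomputable section

namespace Summit.KontsevichZagierPeriods.FermatIsogeny.BetaLinearSector

open scoped BigOperators
open MeasureTheory Set MvPolynomial
open Literature.NumberTheory.Transcendental Literature.NumberTheory.Transcendental.CurvePeriods

/-- `ε^m − ε̄^m = 2i·sin(πm/N)` for `ε = e^{iπ/N}`. [folklore] -/
theorem twoTerm_pow_sub_pow (N m : ℕ) :
    Complex.exp (↑Real.pi * Complex.I / (N : ℂ)) ^ m - Complex.exp (-(↑Real.pi * Complex.I / (N : ℂ))) ^ m =
      2 * Complex.I * Complex.sin (↑Real.pi * (m : ℂ) / (N : ℂ)) := by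
  have h1 : Complex.exp (↑Real.pi * Complex.I / (N : ℂ)) ^ m =
      Complex.exp ((↑Real.pi * (m : ℂ) / (N : ℂ)) * Complex.I) := by
    rw [← Complex.exp_nat_mul]; congr 1; ring
  have h2 : Complex.exp (-(↑Real.pi * Complex.I / (N : ℂ))) ^ m =
      Complex.exp ((-(↑Real.pi * (m : ℂ) / (N : ℂ))) * Complex.I) := by
    rw [← Complex.exp_nat_mul]; congr 1; ring
  rw [h1, h2, Complex.exp_mul_I, Complex.exp_mul_I, Complex.cos_neg, Complex.sin_neg]
  ring

/-- `sin(πr/N) ≠ 0` for `0 < r < N` (as a complex number). [folklore] -/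
theorem twoTerm_sin_ne_zero {N r : ℕ} (hr : 1 ≤ r) (hrN : r < N) :
    Complex.sin (↑Real.pi * (r : ℂ) / (N : ℂ)) ≠ 0 := by
  have hN : (0:ℝ) < N := by exact_mod_cast (show 0 < N by omega)
  have h : Complex.sin (↑Real.pi * (r : ℂ) / (N : ℂ)) = ((Real.sin (Real.pi * r / N) : ℝ) : ℂ) := by
    rw [Complex.ofReal_sin]; push_cast; ring_nf
  rw [h, Complex.ofReal_ne_zero]
  refine (Real.sin_pos_of_pos_of_lt_pi ?_ ?_).ne'
  · have : (0:ℝ) < r := by exact_mod_cast (show 0 < r by omega)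
    positivity
  · have hr' : (r:ℝ) < N := by exact_mod_cast hrN
    rw [div_lt_iff₀ hN]
    nlinarith [Real.pi_pos]

/-- **THE TWO-TERM RELATION** (registered stub `stub_twoTermRelation`): for positive `r, s, t` with `r + s + t = N`,
`(F_N, ω_{r,s}, γ_N) − [sin(π(r+s)/N)/sin(πr/N)]·(F_N, ω_{t,s}, γ_N)` is an algebraic combination of elementary relations;
on periods `B(a,b) sin πa = B(1−a−b,b) sin π(a+b)`. [cite: Gross1978, §1 (Rohrlich's appendix)] -/
theorem stub_twoTermRelation : ∀ (N r s t : ℕ), 3 ≤ N → 1 ≤ r → 1 ≤ s → 1 ≤ t → r + s + t = N →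
    ∀ (hZ : (⟨2, 1, ![X 0 ^ N + X 1 ^ N - 1]⟩ : CurveData).IsSmoothAffineCurve)
      (hω₁ : ∀ l, HasAlgCoeffs ((![X 0 ^ (r - 1) * X 1 ^ s, -(X 0 ^ r * X 1 ^ (s - 1))] :
        Fin 2 → MvPolynomial (Fin 2) ℂ) l))
      (hω₂ : ∀ l, HasAlgCoeffs ((![X 0 ^ (t - 1) * X 1 ^ s, -(X 0 ^ t * X 1 ^ (s - 1))] :
        Fin 2 → MvPolynomial (Fin 2) ℂ) l))
      (γ : CurvePath (⟨2, 1, ![X 0 ^ N + X 1 ^ N - 1]⟩ : CurveData)),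
    (∀ u : ℝ, γ.toFun u = ![(((1 - u) * ((1 - u) ^ N + u ^ N) ^ (-(1:ℝ) / N) : ℝ) : ℂ),
      ((u * ((1 - u) ^ N + u ^ N) ^ (-(1:ℝ) / N) : ℝ) : ℂ)]) →
    ∃ (k : ℕ) (ρ : Fin k → (PeriodSymbol →₀ ℂ)) (a : Fin k → ℂ),
      (∀ l, IsElementaryRelation (ρ l)) ∧ (∀ l, IsAlgebraic ℚ (a l)) ∧
      (Finsupp.single (⟨(⟨2, 1, ![X 0 ^ N + X 1 ^ N - 1]⟩ : CurveData), hZ,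
            (![X 0 ^ (r - 1) * X 1 ^ s, -(X 0 ^ r * X 1 ^ (s - 1))] : Fin 2 → MvPolynomial (Fin 2) ℂ), hω₁, γ⟩ :
            PeriodSymbol) (1 : ℂ) -
          ((Real.sin (Real.pi * (r + s) / N) / Real.sin (Real.pi * r / N) : ℝ) : ℂ) •
            Finsupp.single (⟨(⟨2, 1, ![X 0 ^ N + X 1 ^ N - 1]⟩ : CurveData), hZ,
              (![X 0 ^ (t - 1) * X 1 ^ s, -(X 0 ^ t * X 1 ^ (s - 1))] : Fin 2 → MvPolynomial (Fin 2) ℂ), hω₂, γ⟩ :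
              PeriodSymbol) (1 : ℂ)) =
        ∑ l, a l • ρ l := by
  intro N r s t hN3 hr hs ht hN hZ hω₁ hω₂ γ hγ
  have hN0 : N ≠ 0 := by omega
  have hω₃ : ∀ l, HasAlgCoeffs ((![X 0 ^ (r - 1) * X 1 ^ t, -(X 0 ^ r * X 1 ^ (t - 1))] :
      Fin 2 → MvPolynomial (Fin 2) ℂ) l) := by
    intro l
    fin_cases l
    · exact ((hasAlgCoeffs_X 0).pow (r - 1)).mul ((hasAlgCoeffs_X 1).pow t)
    · exact (((hasAlgCoeffs_X 0).pow r).mul ((hasAlgCoeffs_X 1).pow (t - 1))).neg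
  have hω₄ : ∀ l, HasAlgCoeffs ((![X 0 ^ (t - 1) * X 1 ^ r, -(X 0 ^ t * X 1 ^ (r - 1))] :
      Fin 2 → MvPolynomial (Fin 2) ℂ) l) := by
    intro l
    fin_cases l
    · exact ((hasAlgCoeffs_X 0).pow (t - 1)).mul ((hasAlgCoeffs_X 1).pow r)
    · exact (((hasAlgCoeffs_X 0).pow t).mul ((hasAlgCoeffs_X 1).pow (r - 1))).neg
  -- the two upper sector relations and the swap
  have U1 := stub_upperSector N r s t hN3 hr hs ht hN hZ hω₁ hω₂ hω₃ γ hγ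
  have U2 := stub_upperSector N t s r hN3 ht hs hr (by omega) hZ hω₂ hω₁ hω₄ γ hγ
  have SW := stub_swapRel N t r ht hr hZ hω₄ hω₃ γ γ.reverse (fun u _ => by
    show γ.toFun (1 - u) = _
    rw [hγ (1 - u), hγ u]
    simp only [Matrix.cons_val_one, Matrix.cons_val_zero, sub_sub_cancel, add_comm (u ^ N)])
  have RV := span_single_add_single_reverse hZ _ hω₃ γ
  -- scalar algebra
  have hEB := sectorChart_eps_mul_epsBar N
  have hEt' := upperSector_epsBar_pow_mul (N := N) (r := t) (s := r) (t := s) ht (by omega)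
  have hEt : Complex.exp (↑Real.pi * Complex.I / (N : ℂ)) ^ t =
      -(Complex.exp (-(↑Real.pi * Complex.I / (N : ℂ))) ^ r * Complex.exp (-(↑Real.pi * Complex.I / (N : ℂ))) ^ s) :=
    neg_eq_iff_eq_neg.1 hEt'.symm
  have hsin₁ := twoTerm_pow_sub_pow N r
  have hsin₂ := twoTerm_pow_sub_pow N (r + s)
  have hpow : Complex.exp (↑Real.pi * Complex.I / (N : ℂ)) ^ r =
      Complex.exp (-(↑Real.pi * Complex.I / (N : ℂ))) ^ s * Complex.exp (↑Real.pi * Complex.I / (N : ℂ)) ^ (r + s) := by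
    calc Complex.exp (↑Real.pi * Complex.I / (N : ℂ)) ^ r
        = Complex.exp (↑Real.pi * Complex.I / (N : ℂ)) ^ r *
            (Complex.exp (↑Real.pi * Complex.I / (N : ℂ)) * Complex.exp (-(↑Real.pi * Complex.I / (N : ℂ)))) ^ s := by
          rw [hEB, one_pow, mul_one]
      _ = _ := by ring
  have hS₁ : Complex.sin (↑Real.pi * (r : ℂ) / (N : ℂ)) ≠ 0 := twoTerm_sin_ne_zero hr (by omega)
  have haE : IsAlgebraic ℚ (Complex.exp (↑Real.pi * Complex.I / (N : ℂ))) := sectorPaths_algebraic_eps hN0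
  have haB : IsAlgebraic ℚ (Complex.exp (-(↑Real.pi * Complex.I / (N : ℂ)))) := sectorPaths_algebraic_epsBar hN0
  -- abbreviate
  set E := Complex.exp (↑Real.pi * Complex.I / (N : ℂ)) with hE
  set B := Complex.exp (-(↑Real.pi * Complex.I / (N : ℂ))) with hB
  set S₁ := Complex.sin (↑Real.pi * (r : ℂ) / (N : ℂ)) with hS₁def
  set S₂ := Complex.sin (↑Real.pi * ((r + s : ℕ) : ℂ) / (N : ℂ)) with hS₂def
  -- the coefficient of the combination and the ratio
  have hκ : ((Real.sin (Real.pi * (r + s) / N) / Real.sin (Real.pi * r / N) : ℝ) : ℂ) = S₂ / S₁ := by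
    rw [hS₁def, hS₂def]; push_cast; ring_nf
  have hμ : E ^ t + E ^ r * B ^ s = B ^ s * (2 * Complex.I * S₁) := by linear_combination hEt + B ^ s * hsin₁
  have hμ0 : E ^ t + E ^ r * B ^ s ≠ 0 := by
    rw [hμ]; exact mul_ne_zero (pow_ne_zero _ (Complex.exp_ne_zero _)) (mul_ne_zero (mul_ne_zero two_ne_zero
      Complex.I_ne_zero) hS₁)
  have hν : (E ^ t * B ^ s + E ^ r) * S₁ = (E ^ t + E ^ r * B ^ s) * S₂ := by
    linear_combination -(S₂ - B ^ s * S₁) * hEt - B ^ s * S₂ * hsin₁ + S₁ * hpow + B ^ s * S₁ * hsin₂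
  have haμ : IsAlgebraic ℚ (E ^ t + E ^ r * B ^ s) := (haE.pow t).add ((haE.pow r).mul (haB.pow s))
  -- the combination `ε^t U1 − ε^r U2 − ε^{r+t} (SW − RV)` is `μ (S_rs − κ S_ts)`
  obtain ⟨k, ρ, a, hρ, ha, he⟩ := span_smul haμ.inv (span_sub (span_sub (span_smul (haE.pow t) U1)
    (span_smul (haE.pow r) U2)) (span_smul (haE.pow (r + t)) (span_sub SW RV)))
  refine ⟨k, ρ, a, hρ, ha, ?_⟩
  rw [← he, hκ]
  match_scalars
  · field_simp
    ring
  · field_simp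
    linear_combination hν
  · ring
  · ring
  · ring

end Summit.KontsevichZagierPeriods.FermatIsogeny.BetaLinearSector

end
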